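import Summits.RiemannHypothesis.RiemannHypothesis.Theorems.ScrewLemmaKCoprofileCoprofileIsometry
import Summits.RiemannHypothesis.RiemannHypothesis.Theorems.ScrewLemmaKCoprofileProvisoFree
import HarnessLib

/-!
# LEMMA K♯ with no `L²` proviso (route ScrewLemmaKCoprofile; rung S-P(P1) of the SCREW column)

The tree's `ScrewLemmaKCoprofile.screwSmoothSectorKSharp : IntegerScrew.ScrewSmoothSectorKSharp` (the registered leaf,
which carries the proviso `(h − h₀)²/y² ∈ L¹(0,1)` as a hypothesis) combined with
`ScrewLemmaKCoprofile.integrableOn_profile_sq_div_of_admissible` (the proviso is automatic for admissible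
generators) gives the clean statement: for EVERY admissible `g` (`C¹[0,1]`, `g(1) = 0`, `∫g = 0`, `∫g u^{-1/2} = 0`),

  `(π² − 1) · h₀² ≤ ∫₀¹ (h(y) − h₀)² y⁻² dy`,  `h = latticeProfile g`, `h₀ = −g(0)/2`,

and the integral on the right is a genuine (finite) Lebesgue integral.  RH-free real analysis (mathematics: rh-idea-5
g0, family «LEMMA K♯»); this is NOT a proof of RH and nothing here bears on the truth of RH.
-/

noncomputable section

set_option linter.dupNamespace false

namespace Summit.RiemannHypothesis.RiemannHypothesis.Theorems.ScrewLemmaKCoprofile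

open MeasureTheory Set
open Summit.RiemannHypothesis.RiemannHypothesis.Theorems.IntegerScrew

/-- **LEMMA K♯, proviso-free**: for every admissible generator `g`,
`(π² − 1)·h₀² ≤ ∫₀¹ (h − h₀)² y⁻² dy` (and `(h − h₀)²/y²` is integrable on `(0,1)`, see
`integrableOn_profile_sq_div_of_admissible`).  RH-free. [folklore] -/
theorem screwSmoothSectorKSharp_provisoFree (g : ℝ → ℝ) (hg : SmoothSectorAdmissible g) :
    (Real.pi ^ 2 - 1) * latticePlateau g ^ 2
      ≤ ∫ y in Set.Ioo (0:ℝ) 1, (latticeProfile g y - latticePlateau g) ^ 2 / y ^ 2 := by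
  have h := screwSmoothSectorKSharp
  unfold ScrewSmoothSectorKSharp SmoothSectorKInequality at h
  exact h g hg (integrableOn_profile_sq_div_of_admissible hg)

/-- The proviso-free K♯ in the packaged form `∀ g, admissible g → …`. [folklore] -/
theorem smoothSectorKInequality_sharp_of_admissible :
    ∀ g : ℝ → ℝ, SmoothSectorAdmissible g →
      IntegrableOn (fun y => (latticeProfile g y - latticePlateau g) ^ 2 / y ^ 2) (Set.Ioo 0 1) ∧
      (Real.pi ^ 2 - 1) * latticePlateau g ^ 2
        ≤ ∫ y in Set.Ioo (0:ℝ) 1, (latticeProfile g y - latticePlateau g) ^ 2 / y ^ 2 :=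
  fun g hg => ⟨integrableOn_profile_sq_div_of_admissible hg, screwSmoothSectorKSharp_provisoFree g hg⟩

end Summit.RiemannHypothesis.RiemannHypothesis.Theorems.ScrewLemmaKCoprofile

end
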